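import Summits.QuantumFields.BalabanUV.Beta.GAN24.CombesThomasFibreStep

/-!
# `BalabanUV.Beta.GAN24.FibreStepResidues` — binder row G-an2-4 / (CONV-C), propagator slot, road P1-fibre: BLOCK-TRANSLATION COVARIANCE
# of the step fibre functions `kFib` / `kFibΔ` of `GAN24/CombesThomasFibreStep`, and the RESIDUE REDUCTION of both fibre hypotheses
# (the `∀ x′ y′` of (I2′)/(I3′) is a statement about `Lc^{d+1} × Lc^{d+1}` residue pairs per leg pair)

NOT IN PRINT; OUR PROOF ATTEMPT.  HONEST FRAMING (cell contract, verbatim): «discharging `BetaPertH` makes Bałaban's UV stability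
UNCONDITIONAL — a real constructive-QFT result; it is NOT the continuum limit and NOT the Clay problem.»  HONEST DEPENDENCY (verbatim):
«continuum YM on T⁴ ⇐ BetaPertH ∧ nine spine estimates (0/9 proved); BetaPertH ⇐ (D1) ∧ (D4) ∧ CAP+tail; G-an2-4 gates asym, D1 and
NE2/3/4.»  [folklore] bookkeeping over the cell's typed objects (an2's `OneStepKernelFamily.legPt`, gan24-p1's `legOff`/`kFib`/`kFibΔ`,
lit2's `cphase`): integer block arithmetic and the additivity of the Bloch character.  Cites nothing, mints no fact, instantiates NO wall
binder, proves NO estimate.  NOT summit progress.  (Unit b2b-balaban-gan24-formalise-leaf-01, self-row helper P1-L03b on the landed leaf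
P1-L03; kernel form of INFO I1 of the cross-read certificate `XREAD-CTFS-v1`.)

## What is proved (generic `d`, `Lc ≥ 1`, units `sf sm : ℕ → ℝ` as parameters, complex momentum `p` unless said)
§1 leg geometry under a block translation `x′ ↦ x′ + Lc•v` of the step-`j` lattice (`M = Lc^j`, `N = Lc^(j+1)`):
   `legPt_add_zsmul` (`legPt M a (x′ + L•v) i = legPt M a x′ i + (M·L)•v`), `legIdx_add_zsmul` (the fibre index does not see `N`-translations),
   `legOff_add_zsmul_left/right` (the block offset shifts by `± v`).
§2 covariance: `kFib_add_zsmul_left`  — `kFib Lc sf sm j a (x′ + Lc•v) b y′ p = cphase v p · kFib Lc sf sm j a x′ b y′ p`;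
   `kFib_add_zsmul_right` — `kFib … b (y′ + Lc•v) p = cphase (−v) p · kFib … p`;
   EXACT INVARIANCE `kFibΔ_add_zsmul_left/right` — `kFibΔ … (x′ + Lc•v) … = kFibΔ … x′ …` (the re-based phases absorb the shift).
§3 residues: `kFibΔ_eq_repZ` — `kFibΔ Lc sf sm j a x′ b y′ = kFibΔ Lc sf sm j a (repZ (proj Lc x′)) b (repZ (proj Lc y′))`;
   `kFib_eq_repZ` — `kFib … x′ … y′ … p = cphase (quo Lc x′ − quo Lc y′) p · kFib … (repZ (proj Lc x′)) … (repZ (proj Lc y′)) … p`;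
   on the real zone the block phase is unimodular (`norm_cphase_ofRealVec`), so `norm_kFib_sub_eq_repZ`: the one-step difference
   `‖kFib (j+1) … − kFib j …‖` at `ofRealVec q` depends on `(x′, y′)` only through the residues.
§4 the two wall reductions of `GAN24/CombesThomasFibreStep` with RESIDUE-ONLY hypotheses:
   `stripRegular_of_repZ`, **`unitDecayK_of_stripRegular_repZ`** ((I3′) asked only at box representatives ⇒ `UnitDecayK`),
   `rate_of_repZ`, **`supRateK_of_kFib_repZ`** ((I2′) asked only at box representatives ⇒ `SupRateK`).
So per `j` each fibre hypothesis is FINITELY many conditions (`Lc^{2(d+1)}` residue pairs × leg types); the `j`-UNIFORMITY remains the whole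
analytic content and is NOT addressed here.  NOT BetaPertH, NOT continuum, NOT Clay.
-/

noncomputable section

open Complex Finset
open scoped BigOperators
open Literature.MathematicalPhysics.QuantumFieldTheory
open Literature.MathematicalPhysics.QuantumFieldTheory.Balaban1983to89
open Literature.MathematicalPhysics.QuantumFieldTheory.Balaban1983to89.Beta
open Literature.Probability.LatticeModels (TorusSite Torus.proj)
open LatticeForm (quo repZ proj_add_zsmul)
open B4Strip (ofRealVec)
open B4ContourShift (BZ StripRegular)
open BlochFibreUniqueness (quo_add_zsmul)
open BlochFibreMatrix (eq_repZ_add_zsmul_quo)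
open FibreInverseDecay (cphase cphase_eq_phaseC)
open OneStepResolventKernel (Fib)
open OneStepKernelFamily (legPt)
open Summit.QuantumFields.BalabanUV.Beta.GAN24.CombesThomas (SupRateK UnitDecayK)
open Summit.QuantumFields.BalabanUV.Beta.GAN24.CombesThomasFibre (legIdx)
open Summit.QuantumFields.BalabanUV.Beta.GAN24.CombesThomasFibreStep

namespace Summit.QuantumFields.BalabanUV.Beta.GAN24.FibreStepResidues

variable {d : ℕ}

/-! ## §1 Leg geometry under block translations -/

/-- [folklore] A leg point moves rigidly with its base: `legPt M a (x′ + L•v) i = legPt M a x′ i + (M·L)•v`. -/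
theorem legPt_add_zsmul (M L : ℕ) (a : Fib d) (x' v : Fin (d + 1) → ℤ) (i : (Fin (d + 1) → ℕ) × ℕ) :
    legPt M a (x' + (L : ℤ) • v) i = legPt M a x' i + ((M * L : ℕ) : ℤ) • v := by
  cases a with
  | inl κ =>
      funext j
      simp only [legPt, Pi.add_apply, Pi.smul_apply, smul_eq_mul, Nat.cast_mul]
      ring
  | inr κ =>
      funext j
      simp only [legPt, Pi.add_apply, Pi.smul_apply, smul_eq_mul, Nat.cast_mul]
      ring

/-- [folklore] The fibre index of a leg (torus coordinate of a field leg; the constant multiplier slot) is invariant under `N`-translations. -/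
theorem legIdx_add_zsmul {N : ℕ} [NeZero N] (a : Fib d) (P v : Fin (d + 1) → ℤ) :
    legIdx N a (P + (N : ℤ) • v) = legIdx N a P := by
  cases a with
  | inl κ =>
      show (Sum.inl (κ, Torus.proj N (P + (N : ℤ) • v)) : BlochFibreMatrix.Idx (d + 1) N) = Sum.inl (κ, Torus.proj N P)
      rw [proj_add_zsmul]
  | inr κ => rfl

variable {Lc : ℕ} [NeZero Lc]

omit [NeZero Lc] in
/-- [folklore] `Lc^j · Lc = Lc^(j+1)` as an integer cast. -/
theorem cast_pow_mul (j : ℕ) : ((Lc ^ j * Lc : ℕ) : ℤ) = ((Lc ^ (j + 1) : ℕ) : ℤ) := by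
  rw [← pow_succ]

/-- [folklore] The block offset of a leg pair shifts by `+v` when the first base point is translated by `Lc•v`. -/
theorem legOff_add_zsmul_left (j : ℕ) (a b : Fib d) (x' y' v : Fin (d + 1) → ℤ) (i i' : (Fin (d + 1) → ℕ) × ℕ) :
    legOff (Lc ^ (j + 1)) (Lc ^ j) a (x' + (Lc : ℤ) • v) i b y' i' = legOff (Lc ^ (j + 1)) (Lc ^ j) a x' i b y' i' + v := by
  unfold legOff
  rw [legPt_add_zsmul, cast_pow_mul, quo_add_zsmul]
  abel

/-- [folklore] The block offset of a leg pair shifts by `−v` when the second base point is translated by `Lc•v`. -/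
theorem legOff_add_zsmul_right (j : ℕ) (a b : Fib d) (x' y' v : Fin (d + 1) → ℤ) (i i' : (Fin (d + 1) → ℕ) × ℕ) :
    legOff (Lc ^ (j + 1)) (Lc ^ j) a x' i b (y' + (Lc : ℤ) • v) i' = legOff (Lc ^ (j + 1)) (Lc ^ j) a x' i b y' i' - v := by
  unfold legOff
  rw [legPt_add_zsmul, cast_pow_mul, quo_add_zsmul]
  abel

/-! ## §2 Covariance of `kFib`, invariance of `kFibΔ` -/

/-- [folklore] **BLOCK-TRANSLATION COVARIANCE, first argument**: `kFib … (x′ + Lc•v) … p = e^{ip·v} · kFib … x′ … p` — every term of the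
leg sum keeps its inverse-fibre entry (`legIdx_add_zsmul`) and picks up the common phase `cphase v p` (`legOff_add_zsmul_left`). -/
theorem kFib_add_zsmul_left (sf sm : ℕ → ℝ) (j : ℕ) (a b : Fib d) (x' y' v : Fin (d + 1) → ℤ) (p : Fin (d + 1) → ℂ) :
    kFib Lc sf sm j a (x' + (Lc : ℤ) • v) b y' p = cphase v p * kFib Lc sf sm j a x' b y' p := by
  unfold kFib kFibW
  rw [Finset.mul_sum]
  refine Finset.sum_congr rfl fun ii _ => ?_
  rw [legOff_add_zsmul_left, cphase_add_eq_mul, legPt_add_zsmul, cast_pow_mul, legIdx_add_zsmul]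
  ring

/-- [folklore] **BLOCK-TRANSLATION COVARIANCE, second argument**: `kFib … (y′ + Lc•v) … p = e^{−ip·v} · kFib … y′ … p`. -/
theorem kFib_add_zsmul_right (sf sm : ℕ → ℝ) (j : ℕ) (a b : Fib d) (x' y' v : Fin (d + 1) → ℤ) (p : Fin (d + 1) → ℂ) :
    kFib Lc sf sm j a x' b (y' + (Lc : ℤ) • v) p = cphase (-v) p * kFib Lc sf sm j a x' b y' p := by
  unfold kFib kFibW
  rw [Finset.mul_sum]
  refine Finset.sum_congr rfl fun ii _ => ?_
  rw [legOff_add_zsmul_right, sub_eq_add_neg, cphase_add_eq_mul, legPt_add_zsmul, cast_pow_mul, legIdx_add_zsmul]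
  ring

/-- [folklore] **EXACT INVARIANCE of the re-based fibre function, first argument**: `kFibΔ … (x′ + Lc•v) … = kFibΔ … x′ …`
(the prefactor `cphase (quo y′ − quo x′)` loses exactly the phase `cphase v` that `kFib` gains). -/
theorem kFibΔ_add_zsmul_left (sf sm : ℕ → ℝ) (j : ℕ) (a b : Fib d) (x' y' v : Fin (d + 1) → ℤ) :
    kFibΔ Lc sf sm j a (x' + (Lc : ℤ) • v) b y' = kFibΔ Lc sf sm j a x' b y' := by
  funext p
  unfold kFibΔ
  rw [quo_add_zsmul, kFib_add_zsmul_left, ← mul_assoc, ← cphase_add_eq_mul]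
  congr 2
  abel

/-- [folklore] **EXACT INVARIANCE of the re-based fibre function, second argument**: `kFibΔ … (y′ + Lc•v) = kFibΔ … y′`. -/
theorem kFibΔ_add_zsmul_right (sf sm : ℕ → ℝ) (j : ℕ) (a b : Fib d) (x' y' v : Fin (d + 1) → ℤ) :
    kFibΔ Lc sf sm j a x' b (y' + (Lc : ℤ) • v) = kFibΔ Lc sf sm j a x' b y' := by
  funext p
  unfold kFibΔ
  rw [quo_add_zsmul, kFib_add_zsmul_right, ← mul_assoc, ← cphase_add_eq_mul]
  congr 2
  abel

/-! ## §3 Reduction to box representatives (residues mod `Lc`) -/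

/-- [folklore] `kFibΔ` along any block decomposition of its two base points. -/
theorem kFibΔ_of_decomp (sf sm : ℕ → ℝ) (j : ℕ) (a b : Fib d) {x' y' r r' q q' : Fin (d + 1) → ℤ}
    (hx : x' = r + (Lc : ℤ) • q) (hy : y' = r' + (Lc : ℤ) • q') :
    kFibΔ Lc sf sm j a x' b y' = kFibΔ Lc sf sm j a r b r' := by
  subst hx hy
  rw [kFibΔ_add_zsmul_left, kFibΔ_add_zsmul_right]

/-- [folklore] **RESIDUE FORM of `kFibΔ`**: it depends on the base points only through their box representatives
`repZ (proj Lc x′)`, `repZ (proj Lc y′)` (`x = repZ (proj Lc x) + Lc • quo Lc x`). -/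
theorem kFibΔ_eq_repZ (sf sm : ℕ → ℝ) (j : ℕ) (a b : Fib d) (x' y' : Fin (d + 1) → ℤ) :
    kFibΔ Lc sf sm j a x' b y' = kFibΔ Lc sf sm j a (repZ (Torus.proj Lc x')) b (repZ (Torus.proj Lc y')) :=
  kFibΔ_of_decomp sf sm j a b (eq_repZ_add_zsmul_quo (N := Lc) x') (eq_repZ_add_zsmul_quo (N := Lc) y')

/-- [folklore] `kFib` along any block decomposition of its two base points: a global phase `cphase (q − q′)`. -/
theorem kFib_of_decomp (sf sm : ℕ → ℝ) (j : ℕ) (a b : Fib d) {x' y' r r' q q' : Fin (d + 1) → ℤ}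
    (hx : x' = r + (Lc : ℤ) • q) (hy : y' = r' + (Lc : ℤ) • q') (p : Fin (d + 1) → ℂ) :
    kFib Lc sf sm j a x' b y' p = cphase (q - q') p * kFib Lc sf sm j a r b r' p := by
  subst hx hy
  rw [kFib_add_zsmul_left, kFib_add_zsmul_right, ← mul_assoc, ← cphase_add_eq_mul, sub_eq_add_neg]

/-- [folklore] **RESIDUE FORM of `kFib`**: `kFib … x′ … y′ … p = e^{ip·(quo x′ − quo y′)} · kFib … (repZ (proj Lc x′)) … (repZ (proj Lc y′)) … p` —
the block indices enter only through ONE global phase (the same for every `j`). -/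
theorem kFib_eq_repZ (sf sm : ℕ → ℝ) (j : ℕ) (a b : Fib d) (x' y' : Fin (d + 1) → ℤ) (p : Fin (d + 1) → ℂ) :
    kFib Lc sf sm j a x' b y' p =
      cphase (quo Lc x' - quo Lc y') p * kFib Lc sf sm j a (repZ (Torus.proj Lc x')) b (repZ (Torus.proj Lc y')) p :=
  kFib_of_decomp sf sm j a b (eq_repZ_add_zsmul_quo (N := Lc) x') (eq_repZ_add_zsmul_quo (N := Lc) y') p

omit [NeZero Lc] in
/-- [folklore] On the real zone the Bloch character is unimodular: `‖cphase v (ofRealVec q)‖ = 1`. -/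
theorem norm_cphase_ofRealVec (v : Fin (d + 1) → ℤ) (q : Fin (d + 1) → ℝ) : ‖cphase v (ofRealVec q)‖ = 1 := by
  rw [cphase_eq_phaseC, B4Green244.phaseC_ofRealVec]
  exact B4ContourShift.norm_cexp_phase q v

/-- [folklore] **THE ONE-STEP DIFFERENCE ON THE REAL ZONE SEES ONLY RESIDUES**: at real momentum the common block phase drops out of the norm,
`‖kFib (j+1) … x′ y′ − kFib j … x′ y′‖ = ‖kFib (j+1) … (repZ ·) (repZ ·) − kFib j … (repZ ·) (repZ ·)‖`. -/
theorem norm_kFib_sub_eq_repZ (sf sm : ℕ → ℝ) (j : ℕ) (a b : Fib d) (x' y' : Fin (d + 1) → ℤ) (q : Fin (d + 1) → ℝ) :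
    ‖kFib Lc sf sm (j + 1) a x' b y' (ofRealVec q) - kFib Lc sf sm j a x' b y' (ofRealVec q)‖ =
      ‖kFib Lc sf sm (j + 1) a (repZ (Torus.proj Lc x')) b (repZ (Torus.proj Lc y')) (ofRealVec q) -
          kFib Lc sf sm j a (repZ (Torus.proj Lc x')) b (repZ (Torus.proj Lc y')) (ofRealVec q)‖ := by
  rw [kFib_eq_repZ sf sm (j + 1), kFib_eq_repZ sf sm j, ← mul_sub, norm_mul, norm_cphase_ofRealVec, one_mul]

/-! ## §4 The two wall reductions with residue-only hypotheses -/

/-- [folklore] (I3′) AT BOX REPRESENTATIVES ⇒ (I3′) EVERYWHERE: a strip bound for `kFibΔ … (repZ zx) … (repZ zy)` over the finitely many residue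
pairs is a strip bound for all base points (`kFibΔ_eq_repZ`). -/
theorem stripRegular_of_repZ (sf sm : ℕ → ℝ) {κ Cst : ℝ}
    (h : ∀ j (zx zy : TorusSite (d + 1) Lc) (a b : Fib d), StripRegular (kFibΔ Lc sf sm j a (repZ zx) b (repZ zy)) κ Cst) :
    ∀ j (x' y' : Fin (d + 1) → ℤ) (a b : Fib d), StripRegular (kFibΔ Lc sf sm j a x' b y') κ Cst := by
  intro j x' y' a b
  rw [kFibΔ_eq_repZ]
  exact h j _ _ a b

/-- [folklore] **(I3′) AT BOX REPRESENTATIVES ⇒ `UnitDecayK`** (`CombesThomasFibreStep.unitDecayK_of_stripRegular` with its `∀ x′ y′` hypothesis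
reduced to the `Lc^{d+1} × Lc^{d+1}` residue pairs): same constants `Cst·e^{2κ}`, `κ/((d+1)·Lc)`.  The `j`-uniformity is NOT addressed. -/
theorem unitDecayK_of_stripRegular_repZ (sf sm : ℕ → ℝ) {κ Cst : ℝ} (hκ : 0 ≤ κ)
    (h : ∀ j (zx zy : TorusSite (d + 1) Lc) (a b : Fib d), StripRegular (kFibΔ Lc sf sm j a (repZ zx) b (repZ zy)) κ Cst) :
    UnitDecayK d Lc sf sm (Cst * Real.exp (2 * κ)) (κ / ((d + 1) * Lc)) :=
  unitDecayK_of_stripRegular sf sm hκ (stripRegular_of_repZ sf sm h)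

/-- [folklore] (I2′) AT BOX REPRESENTATIVES ⇒ (I2′) EVERYWHERE on the real zone (`norm_kFib_sub_eq_repZ`). -/
theorem rate_of_repZ (sf sm : ℕ → ℝ) {c θ : ℝ}
    (h : ∀ j (zx zy : TorusSite (d + 1) Lc) (a b : Fib d), ∀ q ∈ BZ (d + 1),
      ‖kFib Lc sf sm (j + 1) a (repZ zx) b (repZ zy) (ofRealVec q) - kFib Lc sf sm j a (repZ zx) b (repZ zy) (ofRealVec q)‖ ≤ c * θ ^ j) :
    ∀ j (x' y' : Fin (d + 1) → ℤ) (a b : Fib d), ∀ q ∈ BZ (d + 1),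
      ‖kFib Lc sf sm (j + 1) a x' b y' (ofRealVec q) - kFib Lc sf sm j a x' b y' (ofRealVec q)‖ ≤ c * θ ^ j := by
  intro j x' y' a b q hq
  rw [norm_kFib_sub_eq_repZ]
  exact h j _ _ a b q hq

/-- [folklore] **(I2′) AT BOX REPRESENTATIVES ⇒ `SupRateK`** (`CombesThomasFibreStep.supRateK_of_kFib` with its `∀ x′ y′` hypothesis reduced to
residue pairs): same `c, θ`.  The `j`-uniformity is NOT addressed. -/
theorem supRateK_of_kFib_repZ (sf sm : ℕ → ℝ) {c θ : ℝ} (hc : 0 ≤ c) (hθ : 0 ≤ θ)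
    (h : ∀ j (zx zy : TorusSite (d + 1) Lc) (a b : Fib d), ∀ q ∈ BZ (d + 1),
      ‖kFib Lc sf sm (j + 1) a (repZ zx) b (repZ zy) (ofRealVec q) - kFib Lc sf sm j a (repZ zx) b (repZ zy) (ofRealVec q)‖ ≤ c * θ ^ j) :
    SupRateK d Lc sf sm c θ :=
  supRateK_of_kFib sf sm hc hθ (rate_of_repZ sf sm h)

end Summit.QuantumFields.BalabanUV.Beta.GAN24.FibreStepResidues

end
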